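import Summits.Ventures.CertifiedManyBodySolver.Theorems.M3x2EdgeSplitSymReplayBoxCanonZ

/-!
# SymReplay — E5 ORACLE: the packed box canon as a hint emitter (executable only; no soundness obligation)

`…OracleCanon` verifies, per residual term, an untrusted hint `HintT {γ, v, partner}` with the tree's own `nfWord` of the moved word and
is sound for EVERY oracle.  This file supplies the fast oracle: hub-lb-sym-ref-1 g1's PACKED box canon (a normal-ordered word = two sorted
arrays of mode codes `2·s + σ`, `s = (x₀+12)·25 + (x₁+12)`; the eight `D₄` images = eight precomputed permutation arrays on the 625 site
codes of the box `[−12,12]²`; anchoring = subtract the min corner; re-sort each block with its parity; representative = lexicographic minimum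
over the eight images; zero iff the minimum occurs with both signs) and the ADAPTER `oracleP : Word → HintT` (`γ = γof k`,
`v = mkSite (−amin) (−bmin)`, partner from `zeroWith`).  Nothing here needs to be — or is — proved: a wrong hint can only make a module fact
`outOKHBZ … = true` fail to evaluate to `true`.

MEASURED (hub-lb-sym-plan-1 g4, pub `hub-lb-sym-plan-1/e5/OraclePacked_check.lean`, interpreted = gate mode, first 2 000 residual words of
rung V's `Pg0`, 13 546 letters): `oracleP` 216 µs/word; `canonTermHWBZ lo hi (oracleP w) (1, w)` 270 µs/word INCLUDING the oracle, against
`canonTermABZ` 829 and `canonTermAB` 1 878 µs/word in the same run (÷3.1 / ÷7.0); termwise syntactic agreement with the canon of record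
2 000/2 000 (zero classes 0); pipe level on the 2 000-term polynomial `canonNFZHBZ` 1 074 ms vs `canonNFZBZ` 2 202 ms, outputs semantically
equal; hint verification failures 0 (also 0 / 10 000 + 10 000 in hub-lb-sym-ref-1 g1's runs).

CONTENTS.  `PW`, `encSite`/`encMode`/`encW`, `decSite`/`decLetter`/`decW`, `d4ab`, `permTab`, `sortPar`, `keyLt`/`keyEq`, `imageK`,
`Hint`, `canonPH`, `γof` (kernel v2 of hub-lb-sym-ref-1 g1, verbatim), `oracleP`.

CLOSING GRAMMAR: as `…OracleCanon` with `oracle := oracleP`: per module `theorem out_i : outOKHBZ K oracleP κ J lo hi i = true := by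
native_decide`; close `energyDensity_ge_of_outrouteHBZ K hwf hRok oracleP κ J hJ lo hi hbox ⟨out_0, …, trivial⟩`.  The box is fixed to
`[−12,12]²` by `encSite`/`permTab` (rung V's `lo = (−12,−12)`, `hi = (12,12)`); another box needs its own table — a hint outside the box is
merely rejected by the verifier.

HONEST FRAMING: an executable hint emitter; no theorem; no certificate is replayed here; no bound of record moves; no summit or crux
statement is proved; nothing here predicts superconductivity.
-/

namespace Summit.Ventures.CertifiedManyBodySolver.Theorems.SymReplay.E5OracleP

open Summit.Ventures.CertifiedManyBodySolver.Theorems.SymReplay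
open Literature.MathematicalPhysics.QuantumLattice
open Literature.MathematicalPhysics.QuantumLattice.HubbardWave0
open Literature.Probability.LatticeModels

/-- (check-variant stub of `…OracleCanon.HintT`) -/
structure HintT where
  γ : DihedralGroup 4
  v : Site 2
  partner : Option (DihedralGroup 4 × Site 2)

/-- Packed normal-ordered word: creator modes ascending, annihilator modes ascending. -/
structure PW where
  cre : Array ℕ
  ann : Array ℕ
deriving Inhabited

/-- Site code `s = (x₀+12)·25 + (x₁+12) ∈ [0,625)` for the box `[−12,12]²`. -/
def encSite (x : Site 2) : ℕ := (x 0 + 12).toNat * 25 + (x 1 + 12).toNat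
/-- Mode code `2·s + σ`. -/
def encMode (ℓ : Letter) : ℕ := 2 * encSite ℓ.x + ℓ.s.val
/-- Pack a normal-ordered word (creators, then annihilators). -/
def encW (w : Word) : PW :=
  ⟨((w.filter fun ℓ => ℓ.dag).map encMode).toArray, ((w.filter fun ℓ => !ℓ.dag).map encMode).toArray⟩
/-- Decode a site code. -/
def decSite (s : ℕ) : Site 2 := mkSite (((s / 25 : ℕ) : ℤ) - 12) (((s % 25 : ℕ) : ℤ) - 12)
/-- Decode a mode code with its dagger flag. -/
def decLetter (m : ℕ) (dag : Bool) : Letter := ⟨decSite (m / 2), ⟨m % 2, Nat.mod_lt _ (by decide)⟩, dag⟩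
/-- Unpack to a tree word. -/
def decW (p : PW) : Word := (p.cre.toList.map fun m => decLetter m true) ++ (p.ann.toList.map fun m => decLetter m false)

/-- The eight `D₄` maps on box coordinates `(a,b) ∈ [0,24]²` about the box centre. -/
def d4ab (k a b : ℕ) : ℕ × ℕ :=
  match k with
  | 0 => (a, b)
  | 1 => (24 - b, a)
  | 2 => (24 - a, 24 - b)
  | 3 => (b, 24 - a)
  | 4 => (a, 24 - b)
  | 5 => (b, a)
  | 6 => (24 - a, b)
  | _ => (24 - b, 24 - a)

/-- Eight permutation arrays on the 625 site codes. -/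
def permTab : Array (Array ℕ) :=
  (Array.range 8).map fun k => (Array.range 625).map fun s => let ab := d4ab k (s / 25) (s % 25); ab.1 * 25 + ab.2

/-- Insertion sort of a small array, returning the parity (true = odd) of the sorting permutation. -/
def sortPar (a0 : Array ℕ) : Array ℕ × Bool := Id.run do
  let mut a := a0
  let mut odd := false
  for i in [1:a0.size] do
    let mut j := i
    while j > 0 && a[j-1]! > a[j]! do
      a := a.swapIfInBounds (j-1) j
      odd := !odd
      j := j - 1
  return (a, odd)

/-- Lexicographic `<` on equal-length key arrays. -/
def keyLt (a b : Array ℕ) : Bool := Id.run do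
  for i in [0:a.size] do
    if a[i]! < b[i]! then return true
    if a[i]! > b[i]! then return false
  return false

/-- Key equality. -/
def keyEq (a b : Array ℕ) : Bool := a == b

/-- Image `k` of a packed word: permute sites, anchor at the min corner, re-sort blocks;
returns (cre', ann', odd-sign, amin, bmin) where (amin, bmin) is the subtracted corner in box coordinates (the E5 hint's translation). -/
def imageK (P : Array ℕ) (w : PW) : Array ℕ × Array ℕ × Bool × ℕ × ℕ := Id.run do
  let cs := w.cre.map fun m => (P[m / 2]!, m % 2)
  let as := w.ann.map fun m => (P[m / 2]!, m % 2)
  let mut amin := 25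
  let mut bmin := 25
  for (s, _) in cs do
    if s / 25 < amin then amin := s / 25
    if s % 25 < bmin then bmin := s % 25
  for (s, _) in as do
    if s / 25 < amin then amin := s / 25
    if s % 25 < bmin then bmin := s % 25
  let sh := amin * 25 + bmin
  let (c1, o1) := sortPar (cs.map fun (s, σ) => 2 * (s - sh) + σ)
  let (a1, o2) := sortPar (as.map fun (s, σ) => 2 * (s - sh) + σ)
  return (c1, a1, o1 != o2, amin, bmin)

/-- E5 ORACLE output (sym-eng-3 g2, STATUS l.1815): the chosen image index `k` (γ = `γof k`), its anchoring corner `(amin, bmin)`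
(tree translation `v = mkSite (−amin) (−bmin)`), the sign, the representative, and — when the class is ZERO — a partner index `k'`
whose image has the same word with the opposite sign. -/
structure Hint where
  k : ℕ
  amin : ℕ
  bmin : ℕ
  neg : Bool
  rep : PW
  zeroWith : Option (ℕ × ℕ × ℕ)   -- (k', amin', bmin') of an opposite-sign equal image, if any
deriving Inhabited

/-- The packed box canon of one packed word, emitting the E5 hint: best image index, its anchoring corner, sign, representative,
and a partner index with the opposite sign when the class is zero (hub-lb-sym-ref-1 g1, kernel v2). -/
def canonPH (tab : Array (Array ℕ)) (w : PW) : Hint := Id.run do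
  let (c0, a0, o0, am0, bm0) := imageK tab[0]! w
  let mut bestKey := c0 ++ a0
  let mut h : Hint := ⟨0, am0, bm0, o0, ⟨c0, a0⟩, none⟩
  for k in [1:8] do
    let (c, a, o, am, bm) := imageK tab[k]! w
    let key := c ++ a
    if keyLt key bestKey then
      bestKey := key
      h := ⟨k, am, bm, o, ⟨c, a⟩, none⟩
    else if keyEq key bestKey then
      if o != h.neg then
        if h.zeroWith.isNone then h := { h with zeroWith := some (k, am, bm) }
  return h

/-- The γ realised by permutation array `k` (box centred at the origin ⇒ pure point-group element, translation separate). -/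
def γof (k : ℕ) : DihedralGroup 4 :=
  match k with
  | 0 => .r 0 | 1 => .r 1 | 2 => .r 2 | 3 => .r 3 | 4 => .sr 0 | 5 => .sr 3 | 6 => .sr 2 | _ => .sr 1

/-- **The E5 oracle**: packed box canon → tree hint (`γ = γof k`, `v = mkSite (−amin) (−bmin)`, partner from `zeroWith`). -/
def oracleP (w : Word) : HintT :=
  let h := canonPH permTab (encW w)
  ⟨γof h.k, mkSite (-(h.amin : ℤ)) (-(h.bmin : ℤ)), h.zeroWith.map fun z => (γof z.1, mkSite (-(z.2.1 : ℤ)) (-(z.2.2 : ℤ)))⟩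

end Summit.Ventures.CertifiedManyBodySolver.Theorems.SymReplay.E5OracleP
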